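import Summits.Langlands.Langlands.Theses.CMFern
import Summits.Langlands.Langlands.Theorems.EisensteinDegreeShiftSectorComplementStubAvatarConjugacy
import HarnessLib

/-!
# `CMFern.CorrespondentUnique` (stmt-Langlands-13902) — proved BY NAME

Uniqueness of the Galois correspondent, datum-free: if `ρ` is irreducible and `ρ`, `ρ'` are both
Satake–Frobenius compatible almost everywhere (through `ι`) with the same cuspidal `π`, then `ρ'` is
`GL_n(ℚ̄_ℓ)`-conjugate to `ρ` (Chebotarev density + Brauer–Nesbitt + irreducibility transfer;
Deligne–Serre 1974, Lemme 3.2).  This is the landed theorem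
`Summit.Langlands.Langlands.Theorems.EisensteinDegreeShiftSectorComplement.stub_avatarConjugacy`
(which closed `PrimeSwitchSplit.AvatarConjugacy`, stmt-Langlands-17844) with the extra, unused
hypothesis `0 < n`; the item is a load-bearing binder of `route-Langlands-CMFern`'s `closes`.
No Literature named fact is consumed.
-/

namespace Summit.Langlands.Langlands.Theorems

set_option linter.dupNamespace false in
/-- **stmt-Langlands-13902** `CMFern.CorrespondentUnique`, by the landed theorem
`EisensteinDegreeShiftSectorComplement.stub_avatarConjugacy` (Deligne–Serre 1974, Lemme 3.2). -/
theorem cmFern_correspondentUnique_proof :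
    Summit.Langlands.Langlands.Theses.CMFern.CorrespondentUnique :=
  fun F _ _ n _hn hcpt π ℓ _ ι ρ ρ' h₀ hρ hρ' =>
    EisensteinDegreeShiftSectorComplement.stub_avatarConjugacy F n hcpt π ℓ ι ρ ρ' h₀ hρ hρ'

end Summit.Langlands.Langlands.Theorems
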